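import Summits.AnomalousDissipation.AnomalousDissipation.Theses.PointSink
import Summits.AnomalousDissipation.AnomalousDissipation.Theorems.ConeDesingularisation.Negative.ConeDesingularisationFalseOfSteadyDSolutionLiouvilleProblem
import Summits.AnomalousDissipation.AnomalousDissipation.Theorems.ConeDesingularisation.Negative.FedConeFlux

/-!
# Disproof of `CascadeSoliton` (stmt-AnomalousDissipation-19036) — POINTER to the disproof of
# `ConeDesingularisation` (stmt-AnomalousDissipation-19034)

`PointFluxCone` (stmt-19033) is PROVED in the tree (`PointFluxCone_of`, a fluxless wild witness), hence
`CascadeSoliton ↔ ConeDesingularisation` (`coneDesingularisation_iff_cascadeSoliton`, p167258); the two cruxes are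
one refutation target and share ONE standing disproof file:
`Summits/AnomalousDissipation/AnomalousDissipation/Cruxes/ConeDesingularisation/Disproof.lean` (§0 shape, §1 shell-mass
floor, §2 refuted strengthenings — finite energy / sub-critical envelope / `L^p` escape —, §3 kill criterion under
Liouville, §4 stub targets, §5 flux transfer). Certified negative lemmas: `Theorems/ConeDesingularisation/Negative/*`
(`FarFieldMass`, `LiouvilleReduction`, `SketchStubs`, `LpEscape`,
`ConeDesingularisationFalseOfSteadyDSolutionLiouvilleProblem`, and the flux-transfer chain `FluxPairing`,
`BlowdownShells`, `FluxTransfer`, `RadialCutoff`, `LogMeanFlux`, `FedConeFlux`).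

State of the attack (2026-08-27, refuter `ad-pointsink-ref-1`): NO KILL of the statement as filed (`L²` shell
matching): a refutation is exactly a Liouville theorem for smooth steady unit-viscosity Navier–Stokes in the
`R^{5/3}`-envelope / DSS-far-field class, missed by every printed criterion (`LpEscape`: `Q ∉ L^p`, `2 ≤ p ≤ 9/2`).
The physically meaningful strengthening — the cone is fed in `L³ × L^{3/2}` — is pinned: such a cone is an inward
point-flux cone of strength exactly `D` (`fedCone_logMeanFlux_eq`), so it is neither `C¹` (classical Euler) nor
renormalisable off the apex (`not_cascadeSoliton_L3fedBy_c1EulerCone`, `not_cascadeSoliton_L3fedBy_renormalisedCone`).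
-/

-- `Summit.<Summit>.<Problem>`: single-conjunct summit, the duplicate namespace is mandated (CONVENTIONS §2).
set_option linter.dupNamespace false

namespace Summit.AnomalousDissipation.AnomalousDissipation.Cruxes.CascadeSoliton.Disproof

open Summit.AnomalousDissipation.AnomalousDissipation.Theses.PointSink
open Summit.AnomalousDissipation.AnomalousDissipation.Theorems.ConeDesingularisation.Negative

/-- The two cruxes coincide: `CascadeSoliton ↔ ConeDesingularisation` (because `PointFluxCone` is proved). -/
theorem cascadeSoliton_iff_coneDesingularisation : CascadeSoliton ↔ ConeDesingularisation :=
  coneDesingularisation_iff_cascadeSoliton.symm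

/-- Pointer (elaboration check): the flux-transfer headline for fed cones. -/
example := @fedCone_logMeanFlux_eq

end Summit.AnomalousDissipation.AnomalousDissipation.Cruxes.CascadeSoliton.Disproof
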